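import Literature.InformationTheory.QuantumCodes.CorrectableRegions
import HarnessLib

/-!
# Bravyi–Poulin–Terhal 2010: `k d² ≤ c n` for 2D-local stabilizer codes — proof

S. Bravyi, D. Poulin, B. Terhal, *Tradeoffs for reliable quantum information storage in 2D systems*, Phys. Rev.
Lett. 104 (2010) 050503 = arXiv:0909.5200 [BravyiPoulinTerhal2010], Eq. (1): «Our main result is an upper bound
`k ≤ c n/d²`. Here `c` is a constant coefficient that depends only on locality of the projectors defining the
codespace and dimension of the Hilbert space describing individual particles.» The tree states the STABILIZER/qubit
case as the named fact `BravyiPoulinTerhal2010_kd2_le_cn` (`LocalityBounds.lean`: for every range `w` there is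
`c > 0` with `k d² ≤ c n` for every stabilizer code on the `L × L` grid with `w`-local generators); this file PROVES
it: `BravyiPoulinTerhal2010_kd2_le_cn_holds`, with the explicit (far from optimal) constant `c(w) = 20736 t⁴`,
`t = max(w, 2) − 1`.

## Proof (the Letter's, pp. 2–4, in the symplectic language; region lemmas in `CorrectableRegions.lean`)

* SQUARES (`sq a b m`: the qubits with coordinates in `[a, a+m) × [b, b+m)`, integer corner, read inside the
  lattice) and FRAMES of thickness `t` around them (`frame`, `≤ 8tm + 16t²` qubits): a generator covered by a
  `(t+1) × (t+1)` square that meets a square block and its complement lies in the frame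
  (`sympSupport_subset_frame_of_crossing` — «the condition `∂M ⊆ BC` is satisfied»).
* GROWTH («`R ≥ d/(cw)`»): `1 × 1` blocks are correctable («any region of size smaller than `d` is correctable»); by
  the expansion Cor. 1 (`IsCorrectableRegion.union_of_crossing`) a correctable `m`-block with a frame of `< d` qubits
  grows to a correctable `(m+2t)`-block; iterating (`exists_isCorrectableRegion_sq`) gives `R ≥ 1` with EVERY
  `R × R` block correctable and `d ≤ 8tR + 16t²`. (Print argues by maximality of `R` and contradiction; this is the
  same argument run forwards.)
* PARTITION of Fig. 1 with period `p = R + t` (for `t ≤ R`): `C` = both coordinates within `t` of a block boundary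
  (`cornerRegion`, `|C| ≤ (3t(L/p + 1))²`), `A` = the `R × R` blocks minus `C` (`blockLabel`), `B` = the corridor
  segments minus `C` (`corridorLabel`); every generator meets at most one block and at most one segment
  (`blockLabel_separated`, `corridorLabel_separated`), each of which sits inside an `R × R` square, so `A` and `B`
  are correctable by the Union Lemma 2 (`isCorrectableRegion_of_fibers`) and `k ≤ |C|` by Eqs. (5)–(8)
  (`le_card_compl_of_isCorrectable`): `le_card_corner_of_isCorrectableRegion_sq`.
* ARITHMETIC: with `d ≤ 24 t p`, `(L/p + 1) p ≤ 2L` and Bravyi–Terhal's `d ≤ (t+1) L`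
  (`BravyiTerhal2009_d_le_c_sqrt_n_holds`, used when the lattice is smaller than one period or `d ≤ 1`), every case
  gives `k d² ≤ 20736 t⁴ L² = c n`; `w ≤ 1` is reduced to `t = 1` by monotonicity of locality in the range
  (`HasLocalGenerators.mono`).

Deliberately NOT here (as for the named fact): commuting-projector / qudit codes (the Letter's generality — the
Disentangling Lemma 1 and Prop. 1 [BV03] are not formalised; for stabilizer codes the Cleaning Lemma replaces
them, as the Letter notes on p. 2), the `D`-dimensional Eq. (2), periodic boundaries, subsystem codes, the
classical Appendix A. No attempt at a good constant.

## References

* [BravyiPoulinTerhal2010] arXiv:0909.5200, read via `lit`: Eq. (1) and definitions (chunk p0002 L56–64, p0003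
  L163–181), proof sketch Eqs. (5)–(8) and «R ≥ d/(cw)» (p0003 L224 – p0004 L294), Def. 1, Cor. 1, Lemma 2
  (p0004 L275–319, p0005 L443–449).
* [BravyiTerhal2009] Thm. 1 (`LocalCodeDistanceBound.lean`) and Lemma 1 (`QuantumSingletonBound.lean`).

## Mathlib / tree search

Tree: `IsCorrectableRegion`, `isCorrectableRegion_of_fibers`, `le_card_compl_of_isCorrectable`,
`IsCorrectableRegion.union_of_crossing`, `fiber` (CorrectableRegions.lean); `InCube`, `IsCubeLocal`,
`HasLocalGenerators`, `sympSupport`, `BravyiPoulinTerhal2010_kd2_le_cn` (LocalityBounds.lean);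
`BravyiTerhal2009_d_le_c_sqrt_n_holds` (LocalCodeDistanceBound.lean). Mathlib: `piFinTwoEquiv`, `Int.card_Ico`,
`Nat.find`, `Nat.div_add_mod'`, `Nat.div_lt_iff_lt_mul`, `Finset.card_le_card_of_injOn`.
-/

namespace Literature.InformationTheory.QuantumCodes

open Matrix Finset Module

variable {n : ℕ}

/-! ### Locality is monotone in the range -/

section Mono

variable {D L : ℕ}

/-- A hypercube with `r^D` vertices is contained in the hypercube with `r'^D ≥ r^D` vertices and the same lowest
corner. [cite: BravyiTerhal2009, §1 p. 3 (hypercube with r^D vertices)] -/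
theorem InCube.mono {r r' : ℕ} (h : r ≤ r') {c x : Fin D → Fin L} (hx : InCube r c x) : InCube r' c x :=
  fun i => ⟨(hx i).1, (hx i).2.trans_le (by omega)⟩

/-- `r`-local implies `r'`-local for `r ≤ r'`. [cite: BravyiTerhal2009, §1.1 Thm. 1 (hypothesis on the generators)] -/
theorem IsCubeLocal.mono {e : Fin n ≃ (Fin D → Fin L)} {r r' : ℕ} (h : r ≤ r') {v : SympVec n}
    (hv : IsCubeLocal e r v) : IsCubeLocal e r' v := by
  obtain ⟨c, hc⟩ := hv
  exact ⟨c, fun i hi => InCube.mono h (hc i hi)⟩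

/-- Local generators of range `r` are local generators of every range `r' ≥ r`.
[cite: BravyiPoulinTerhal2010, Definitions and notations (p. 2: interaction range w)] -/
theorem HasLocalGenerators.mono {e : Fin n ≃ (Fin D → Fin L)} {r r' : ℕ} (h : r ≤ r')
    {S : Submodule (ZMod 2) (SympVec n)} (hS : HasLocalGenerators e r S) : HasLocalGenerators e r' S :=
  hS.trans (Submodule.span_mono fun _ hv => ⟨hv.1, hv.2.mono h⟩)

end Mono

/-! ### Boxes and squares on the `L × L` grid -/

section Grid

variable {L : ℕ} (e : Fin n ≃ (Fin 2 → Fin L))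

/-- The columns (or rows) `s` of the grid with `a ≤ s < a + m`, for an integer `a` (the window is read inside
`{0,…,L−1}`; it may stick out of the lattice). [cite: BravyiPoulinTerhal2010, p. 2 («square block of size m×m»)] -/
def Icol (L : ℕ) (a : ℤ) (m : ℕ) : Finset (Fin L) :=
  univ.filter fun s => a ≤ ((s : ℕ) : ℤ) ∧ ((s : ℕ) : ℤ) < a + m

/-- The qubits whose first coordinate lies in `U` and second coordinate in `V`.
[cite: BravyiPoulinTerhal2010, p. 2 (blocks of the square lattice)] -/
def box (U V : Finset (Fin L)) : Finset (Fin n) := univ.filter fun q => e q 0 ∈ U ∧ e q 1 ∈ V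

/-- The **square block** of side `m` with lowest corner `(a, b) ∈ ℤ²`, read inside the lattice: the qubits `q` with
`a ≤ x(q) < a + m` and `b ≤ y(q) < b + m`. [cite: BravyiPoulinTerhal2010, p. 2 («any square block of size m×m»)] -/
def sq (a b : ℤ) (m : ℕ) : Finset (Fin n) := box e (Icol L a m) (Icol L b m)

/-- The **frame** of thickness `t` on both sides of the perimeter of the square `sq a b m`: the union of four
strips of `2t` columns/rows around its four sides (the region `BC` of Cor. 1 / Fig. 2: «`B` and `C` as layers of
thickness `w` adjacent to the surface of `M` such that `B ⊆ M` and `C ⊆ M̄`»).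
[cite: BravyiPoulinTerhal2010, p. 3 (proof sketch after Cor. 1, Fig. 2)] -/
def frame (a b : ℤ) (m t : ℕ) : Finset (Fin n) :=
  box e (Icol L (a - t) (2 * t)) (Icol L (b - t) (m + 2 * t)) ∪
    box e (Icol L (a + m - t) (2 * t)) (Icol L (b - t) (m + 2 * t)) ∪
    box e (Icol L (a - t) (m + 2 * t)) (Icol L (b - t) (2 * t)) ∪
    box e (Icol L (a - t) (m + 2 * t)) (Icol L (b + m - t) (2 * t))

variable {e}

/-- Membership in a window of columns. [cite: BravyiPoulinTerhal2010, p. 2] -/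
@[simp] theorem mem_Icol {a : ℤ} {m : ℕ} {s : Fin L} :
    s ∈ Icol L a m ↔ a ≤ ((s : ℕ) : ℤ) ∧ ((s : ℕ) : ℤ) < a + m := by
  simp [Icol]

/-- Membership in a box. [cite: BravyiPoulinTerhal2010, p. 2] -/
@[simp] theorem mem_box {U V : Finset (Fin L)} {q : Fin n} : q ∈ box e U V ↔ e q 0 ∈ U ∧ e q 1 ∈ V := by
  simp [box]

/-- Membership in a square block. [cite: BravyiPoulinTerhal2010, p. 2] -/
theorem mem_sq {a b : ℤ} {m : ℕ} {q : Fin n} :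
    q ∈ sq e a b m ↔ a ≤ ((e q 0 : ℕ) : ℤ) ∧ ((e q 0 : ℕ) : ℤ) < a + m ∧
      b ≤ ((e q 1 : ℕ) : ℤ) ∧ ((e q 1 : ℕ) : ℤ) < b + m := by
  simp [sq, and_assoc]

/-- Membership in a frame. [cite: BravyiPoulinTerhal2010, p. 3] -/
theorem mem_frame {a b : ℤ} {m t : ℕ} {q : Fin n} :
    q ∈ frame e a b m t ↔
      (a - t ≤ ((e q 0 : ℕ) : ℤ) ∧ ((e q 0 : ℕ) : ℤ) < a - t + (2 * t : ℕ) ∧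
          b - t ≤ ((e q 1 : ℕ) : ℤ) ∧ ((e q 1 : ℕ) : ℤ) < b - t + (m + 2 * t : ℕ)) ∨
        (a + m - t ≤ ((e q 0 : ℕ) : ℤ) ∧ ((e q 0 : ℕ) : ℤ) < a + m - t + (2 * t : ℕ) ∧
          b - t ≤ ((e q 1 : ℕ) : ℤ) ∧ ((e q 1 : ℕ) : ℤ) < b - t + (m + 2 * t : ℕ)) ∨
        (a - t ≤ ((e q 0 : ℕ) : ℤ) ∧ ((e q 0 : ℕ) : ℤ) < a - t + (m + 2 * t : ℕ) ∧
          b - t ≤ ((e q 1 : ℕ) : ℤ) ∧ ((e q 1 : ℕ) : ℤ) < b - t + (2 * t : ℕ)) ∨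
        (a - t ≤ ((e q 0 : ℕ) : ℤ) ∧ ((e q 0 : ℕ) : ℤ) < a - t + (m + 2 * t : ℕ) ∧
          b + m - t ≤ ((e q 1 : ℕ) : ℤ) ∧ ((e q 1 : ℕ) : ℤ) < b + m - t + (2 * t : ℕ)) := by
  simp only [frame, mem_union, mem_box, mem_Icol, and_assoc, or_assoc]

/-- A window of `m` consecutive columns holds at most `m` columns of the lattice.
[cite: BravyiPoulinTerhal2010, p. 2] -/
theorem card_Icol_le (a : ℤ) (m : ℕ) : #(Icol L a m) ≤ m := by
  calc #(Icol L a m) ≤ #(Finset.Ico a (a + m)) := by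
        refine Finset.card_le_card_of_injOn (fun s : Fin L => ((s : ℕ) : ℤ)) ?_ ?_
        · intro s hs
          have hs' := mem_Icol.1 (mem_coe.1 hs)
          simpa using hs'
        · intro s _ s' _ h
          simp only at h
          exact Fin.ext (by exact_mod_cast h)
    _ = m := by simp

/-- A box has `|U| · |V|` qubits (the lattice is the product of its two coordinate axes).
[cite: BravyiPoulinTerhal2010, p. 2 (square lattice √n × √n)] -/
theorem card_box (U V : Finset (Fin L)) : #(box e U V) = #U * #V := by
  classical
  have hset : box e U V =
      (U ×ˢ V).map (((piFinTwoEquiv fun _ => Fin L).symm.trans e.symm).toEmbedding) := by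
    ext q
    rw [mem_box, Finset.mem_map_equiv, Finset.mem_product]
    simp [piFinTwoEquiv]
  rw [hset, card_map, card_product]

/-- A square block of side `m` has at most `m²` qubits. [cite: BravyiPoulinTerhal2010, p. 2] -/
theorem card_sq_le (a b : ℤ) (m : ℕ) : #(sq e a b m) ≤ m * m := by
  rw [sq, card_box]
  exact Nat.mul_le_mul (card_Icol_le a m) (card_Icol_le b m)

/-- The frame of thickness `t` around a square of side `m` has at most `8tm + 16t²` qubits
(«`|BC| = cwR` for some constant `c`»). [cite: BravyiPoulinTerhal2010, p. 3 (proof sketch after Cor. 1)] -/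
theorem card_frame_le (a b : ℤ) (m t : ℕ) : #(frame e a b m t) ≤ 8 * t * m + 16 * (t * t) := by
  have h1 : #(box e (Icol L (a - t) (2 * t)) (Icol L (b - t) (m + 2 * t))) ≤ 2 * t * (m + 2 * t) := by
    rw [card_box]; exact Nat.mul_le_mul (card_Icol_le _ _) (card_Icol_le _ _)
  have h2 : #(box e (Icol L (a + m - t) (2 * t)) (Icol L (b - t) (m + 2 * t))) ≤ 2 * t * (m + 2 * t) := by
    rw [card_box]; exact Nat.mul_le_mul (card_Icol_le _ _) (card_Icol_le _ _)
  have h3 : #(box e (Icol L (a - t) (m + 2 * t)) (Icol L (b - t) (2 * t))) ≤ (m + 2 * t) * (2 * t) := by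
    rw [card_box]; exact Nat.mul_le_mul (card_Icol_le _ _) (card_Icol_le _ _)
  have h4 : #(box e (Icol L (a - t) (m + 2 * t)) (Icol L (b + m - t) (2 * t))) ≤ (m + 2 * t) * (2 * t) := by
    rw [card_box]; exact Nat.mul_le_mul (card_Icol_le _ _) (card_Icol_le _ _)
  have hu := (card_union_le _ _).trans (add_le_add ((card_union_le _ _).trans
    (add_le_add ((card_union_le _ _).trans (add_le_add h1 h2)) h3)) h4)
  refine (hu : #(frame e a b m t) ≤ _).trans (le_of_eq ?_)
  ring

/-- The enlarged square is the square plus its frame: `sq(a−t, b−t, m+2t) ⊆ sq(a,b,m) ∪ frame`.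
[cite: BravyiPoulinTerhal2010, Cor. 1 («M ∪ C») and p. 3 («M ∪ C is a square block of size larger than R»)] -/
theorem sq_subset_sq_union_frame (a b : ℤ) (m t : ℕ) :
    sq e (a - t) (b - t) (m + 2 * t) ⊆ sq e a b m ∪ frame e a b m t := by
  intro q hq
  rw [mem_union, mem_sq, mem_frame]
  rw [mem_sq] at hq
  push_cast at hq ⊢
  omega

/-- **The boundary of a square lies in its frame.** If a generator covered by a `(t+1) × (t+1)` square meets the
square block `M = sq(a,b,m)` and also its complement, then its whole support lies in the frame of thickness `t`
around `M` («Since all the projectors have size at most `w`, the condition `∂M ⊆ BC` is satisfied»).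
[cite: BravyiPoulinTerhal2010, p. 3 (proof sketch after Cor. 1) and Def. 1 (∂M)] -/
theorem sympSupport_subset_frame_of_crossing {t : ℕ} {v : SympVec n} (hv : IsCubeLocal e (t + 1) v)
    {a b : ℤ} {m : ℕ} (hin : ∃ q ∈ sympSupport v, q ∈ sq e a b m)
    (hout : ∃ q ∈ sympSupport v, q ∉ sq e a b m) : ∀ q ∈ sympSupport v, q ∈ frame e a b m t := by
  obtain ⟨c, hc⟩ := hv
  obtain ⟨q₁, hq₁, hin⟩ := hin
  obtain ⟨q₂, hq₂, hout⟩ := hout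
  intro q hq
  have h1x := hc q₁ hq₁ 0
  have h1y := hc q₁ hq₁ 1
  have h2x := hc q₂ hq₂ 0
  have h2y := hc q₂ hq₂ 1
  have hx := hc q hq 0
  have hy := hc q hq 1
  rw [mem_sq] at hin hout
  rw [mem_frame]
  push_cast
  omega

/-! ### Growing correctable squares (Cor. 1 iterated): every `R × R` square is correctable, `d ≤ 8tR + 16t²` -/

section Squares

variable {G : Type*} {g : G → SympVec n} {S : Submodule (ZMod 2) (SympVec n)} {t d : ℕ}

/-- **One expansion step.** If the generators have range `t + 1`, every square block of side `m` is correctable and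
the frame of thickness `t` has fewer than `d` qubits (`8tm + 16t² < d`), then every square block of side `m + 2t` is
correctable («If `|BC| < d` then `BC` is correctable and Corollary 1 would imply that `M ∪ C` is correctable. But
`M ∪ C` is a square block of size larger than `R`»). [cite: BravyiPoulinTerhal2010, p. 3 (proof sketch after Cor. 1)] -/
theorem isCorrectableRegion_sq_step (hS : S = Submodule.span (ZMod 2) (Set.range g)) (hself : IsSelfOrthogonal S)
    (hg : ∀ a, IsCubeLocal e (t + 1) (g a)) (hdist : HasMinDist S d) {m : ℕ}
    (hm : 8 * t * m + 16 * (t * t) < d) (hsq : ∀ a b, IsCorrectableRegion S (sq e a b m)) (a b : ℤ) :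
    IsCorrectableRegion S (sq e a b (m + 2 * t)) := by
  have h := (hsq (a + t) (b + t)).union_of_crossing g hS hself
    (IsCorrectableRegion.of_card_lt hdist ((card_frame_le (a + t) (b + t) m t).trans_lt hm))
    (fun c hin hout => sympSupport_subset_frame_of_crossing (hg c) hin hout)
  refine h.mono ?_
  have := sq_subset_sq_union_frame (e := e) (a + t) (b + t) m t
  simpa using this

/-- **`R ≥ d/(cw)`.** With generators of range `t + 1` (`t ≥ 1`) and minimum distance `d ≥ 2` there is a block size
`R ≥ 1` such that EVERY `R × R` square block (at any integer position) is correctable and `d ≤ 8tR + 16t²`: start from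
`1 × 1` blocks («any region of size smaller than `d` is correctable») and expand by frames while they have fewer than
`d` qubits («Thus `|BC| ≥ d`, that is, `R ≥ d/(cw) ∼ d`»). [cite: BravyiPoulinTerhal2010, p. 3 (R ≥ d/(cw))] -/
theorem exists_isCorrectableRegion_sq (hS : S = Submodule.span (ZMod 2) (Set.range g))
    (hself : IsSelfOrthogonal S) (hg : ∀ a, IsCubeLocal e (t + 1) (g a)) (hdist : HasMinDist S d)
    (ht : 1 ≤ t) (hd : 2 ≤ d) :
    ∃ R, 1 ≤ R ∧ (∀ a b, IsCorrectableRegion S (sq e a b R)) ∧ d ≤ 8 * t * R + 16 * (t * t) := by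
  classical
  have hex : ∃ j, d ≤ 8 * t * (1 + 2 * t * j) + 16 * (t * t) := by
    refine ⟨d, ?_⟩
    have h : d ≤ t * t * d := by
      calc d = 1 * 1 * d := by ring
        _ ≤ t * t * d := by gcongr
    nlinarith [h]
  have hind : ∀ j, j ≤ Nat.find hex → ∀ a b, IsCorrectableRegion S (sq e a b (1 + 2 * t * j)) := by
    intro j
    induction j with
    | zero =>
      intro _ a b
      refine IsCorrectableRegion.of_card_lt hdist ((card_sq_le a b _).trans_lt ?_)
      omega
    | succ j ih =>
      intro hj a b
      have hlt : 8 * t * (1 + 2 * t * j) + 16 * (t * t) < d := by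
        have := Nat.find_min hex (show j < Nat.find hex by omega)
        omega
      have hstep := isCorrectableRegion_sq_step hS hself hg hdist hlt (ih (by omega)) a b
      rwa [show 1 + 2 * t * (j + 1) = 1 + 2 * t * j + 2 * t by ring]
  exact ⟨1 + 2 * t * Nat.find hex, by omega, hind _ le_rfl, Nat.find_spec hex⟩

end Squares

/-! ### Arithmetic of the block pattern (period `p = R + t`) -/

section Arith

/-- Quotients one apart are a full period apart. [folklore] -/
private theorem div_mul_add_le_of_div_lt {X X' p : ℕ} (h : X / p < X' / p) :
    X / p * p + p ≤ X' / p * p := by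
  have := Nat.mul_le_mul_right p (Nat.succ_le_of_lt h)
  rwa [Nat.succ_mul] at this

/-- Two coordinates at most `t` apart whose smaller one has residue `< R` modulo `R + t` have the same quotient (a
range-`(t+1)` generator meets at most one block of a row of blocks).
[cite: BravyiPoulinTerhal2010, p. 2 («any projector Π_a overlaps with at most one block in A»)] -/
private theorem div_eq_div_of_mod_lt {R t X X' : ℕ} (hX : X % (R + t) < R) (h1 : X ≤ X') (h2 : X' ≤ X + t) :
    X' / (R + t) = X / (R + t) := by
  have hp : 0 < R + t := by omega
  apply le_antisymm
  · have h3 : X' < (X / (R + t) + 1) * (R + t) := by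
      have := Nat.div_add_mod' X (R + t)
      rw [Nat.add_mul, one_mul]
      omega
    exact Nat.le_of_lt_succ ((Nat.div_lt_iff_lt_mul hp).2 h3)
  · exact Nat.div_le_div_right h1

/-- Symmetric form of `div_eq_div_of_mod_lt`. [cite: BravyiPoulinTerhal2010, p. 2] -/
private theorem div_eq_div_of_mod_lt' {R t X X' : ℕ} (hX : X % (R + t) < R) (hX' : X' % (R + t) < R)
    (h1 : X ≤ X' + t) (h2 : X' ≤ X + t) : X / (R + t) = X' / (R + t) := by
  rcases le_total X X' with h | h
  · exact (div_eq_div_of_mod_lt hX h h2).symm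
  · exact div_eq_div_of_mod_lt hX' h h1

/-- Two coordinates at most `t` apart, both with residue `≥ R` modulo `R + t` (`t ≤ R`), have the same quotient (a
generator meets at most one corridor of a given direction). [cite: BravyiPoulinTerhal2010, p. 2 («at most one block in B»)] -/
private theorem div_eq_div_of_le_mod {R t X X' : ℕ} (ht : 1 ≤ t) (hRt : t ≤ R) (hX : R ≤ X % (R + t))
    (hX' : R ≤ X' % (R + t)) (h1 : X ≤ X' + t) (h2 : X' ≤ X + t) : X / (R + t) = X' / (R + t) := by
  have hp : 0 < R + t := by omega
  have hdX := Nat.div_add_mod' X (R + t)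
  have hdX' := Nat.div_add_mod' X' (R + t)
  have hmX := Nat.mod_lt X hp
  have hmX' := Nat.mod_lt X' hp
  by_contra hne
  rcases Nat.lt_or_gt_of_ne hne with h | h
  · have := div_mul_add_le_of_div_lt h; omega
  · have := div_mul_add_le_of_div_lt h; omega

/-- A coordinate with residue `≥ R` and one with residue in `[t, R − t)` are more than `t` apart (a generator cannot
meet a vertical and a horizontal corridor segment). [cite: BravyiPoulinTerhal2010, p. 2 («at most one block in B»)] -/
private theorem false_of_le_mod_of_mod_add_lt {R t X X' : ℕ} (hX : R ≤ X % (R + t)) (hX'1 : t ≤ X' % (R + t))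
    (hX'2 : X' % (R + t) + t < R) (h1 : X ≤ X' + t) (h2 : X' ≤ X + t) : False := by
  have hp : 0 < R + t := by omega
  have hdX := Nat.div_add_mod' X (R + t)
  have hdX' := Nat.div_add_mod' X' (R + t)
  have hmX := Nat.mod_lt X hp
  have hmX' := Nat.mod_lt X' hp
  rcases lt_trichotomy (X / (R + t)) (X' / (R + t)) with h | h | h
  · have := div_mul_add_le_of_div_lt h; omega
  · rw [h] at hdX; omega
  · have := div_mul_add_le_of_div_lt h; omega

/-- Counting lattice columns by residue class: if at most `K` residues modulo `p` satisfy `P`, then at most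
`K (L/p + 1)` of the `L` columns have a residue satisfying `P`.
[cite: BravyiPoulinTerhal2010, p. 2 («The total number of blocks is roughly n/R²»)] -/
private theorem card_filter_mod_le {L p K : ℕ} (hp : 0 < p) (P : ℕ → Prop) [DecidablePred P]
    (hK : #((Finset.range p).filter P) ≤ K) :
    #(univ.filter fun s : Fin L => P ((s : ℕ) % p)) ≤ K * (L / p + 1) := by
  calc #(univ.filter fun s : Fin L => P ((s : ℕ) % p))
      ≤ #(((Finset.range p).filter P) ×ˢ Finset.range (L / p + 1)) := by
        refine Finset.card_le_card_of_injOn (fun s : Fin L => ((s : ℕ) % p, (s : ℕ) / p)) ?_ ?_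
        · intro s hs
          rw [mem_coe, mem_filter] at hs
          rw [mem_coe, mem_product, mem_filter, mem_range, mem_range]
          exact ⟨⟨Nat.mod_lt _ hp, hs.2⟩, Nat.lt_succ_of_le (Nat.div_le_div_right s.isLt.le)⟩
        · intro s _ s' _ h
          simp only [Prod.mk.injEq] at h
          apply Fin.ext
          rw [← Nat.div_add_mod' (s : ℕ) p, ← Nat.div_add_mod' (s' : ℕ) p, h.1, h.2]
    _ = #((Finset.range p).filter P) * (L / p + 1) := by rw [card_product, card_range]
    _ ≤ K * (L / p + 1) := Nat.mul_le_mul_right _ hK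

/-- The residues modulo `R + t` within `t` of a block boundary (`r < t` or `r ≥ R − t`) number at most `3t`
(for `t ≤ R`). [cite: BravyiPoulinTerhal2010, p. 2 («small corner regions taken out which make up the region C»)] -/
private theorem card_badResidues_le {R t : ℕ} (hRt : t ≤ R) :
    #((Finset.range (R + t)).filter fun r => R ≤ r + t ∨ r < t) ≤ 3 * t := by
  obtain ⟨R₁, rfl⟩ := Nat.exists_eq_add_of_le hRt
  calc #((Finset.range (t + R₁ + t)).filter fun r => t + R₁ ≤ r + t ∨ r < t)
      ≤ #(Finset.range t ∪ Finset.Ico R₁ (R₁ + 2 * t)) := by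
        refine card_le_card fun r hr => ?_
        rw [mem_filter, mem_range] at hr
        rw [mem_union, mem_range, mem_Ico]
        omega
    _ ≤ #(Finset.range t) + #(Finset.Ico R₁ (R₁ + 2 * t)) := card_union_le _ _
    _ = 3 * t := by rw [card_range, Nat.card_Ico]; omega

end Arith

/-! ### The partition `Λ = A ⊔ B ⊔ C` of Fig. 1 (blocks of period `R + t`) -/

section Tiling

variable (e)

/-- The columns within `t` of a block boundary: residue modulo `R + t` in `[0, t) ∪ [R − t, R + t)`.
[cite: BravyiPoulinTerhal2010, p. 2 and Fig. 1 (corner regions C)] -/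
def badRes (L R t : ℕ) : Finset (Fin L) :=
  univ.filter fun s => R ≤ (s : ℕ) % (R + t) + t ∨ (s : ℕ) % (R + t) < t

/-- **Region `C`** (the corner regions): both coordinates within `t` of a block boundary. «The regions `A` and `B`
have small corner regions taken out which make up the region `C`.» [cite: BravyiPoulinTerhal2010, p. 2 and Fig. 1] -/
def cornerRegion (R t : ℕ) : Finset (Fin n) := box e (badRes L R t) (badRes L R t)

/-- **Region `A`, labelled by block.** A qubit with both residues `< R` (inside an `R × R` block of the period-`(R+t)`
pattern) and not in `C` gets the label of its block `(x div (R+t), y div (R+t))`; other qubits get `none`.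
[cite: BravyiPoulinTerhal2010, p. 2 and Fig. 1 («The regions A and B consist of blocks of size R×R»)] -/
def blockLabel (R t : ℕ) (q : Fin n) : Option (ℕ × ℕ) :=
  if (e q 0 : ℕ) % (R + t) < R ∧ (e q 1 : ℕ) % (R + t) < R ∧
      ¬ ((R ≤ (e q 0 : ℕ) % (R + t) + t ∨ (e q 0 : ℕ) % (R + t) < t) ∧
          (R ≤ (e q 1 : ℕ) % (R + t) + t ∨ (e q 1 : ℕ) % (R + t) < t)) then
    some ((e q 0 : ℕ) / (R + t), (e q 1 : ℕ) / (R + t))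
  else none

/-- **Region `B`, labelled by corridor segment.** The vertical corridor segments (`x mod (R+t) ≥ R`,
`t ≤ y mod (R+t) < R − t`, label `(true, block)`) and the horizontal ones (`(false, block)`): the streets of width
`t` between the blocks, shortened by `t` at both ends so that distinct segments are `> t` apart.
[cite: BravyiPoulinTerhal2010, p. 2 and Fig. 1] -/
def corridorLabel (R t : ℕ) (q : Fin n) : Option (Bool × ℕ × ℕ) :=
  if R ≤ (e q 0 : ℕ) % (R + t) ∧ t ≤ (e q 1 : ℕ) % (R + t) ∧ (e q 1 : ℕ) % (R + t) + t < R then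
    some (true, (e q 0 : ℕ) / (R + t), (e q 1 : ℕ) / (R + t))
  else if R ≤ (e q 1 : ℕ) % (R + t) ∧ t ≤ (e q 0 : ℕ) % (R + t) ∧ (e q 0 : ℕ) % (R + t) + t < R then
    some (false, (e q 0 : ℕ) / (R + t), (e q 1 : ℕ) / (R + t))
  else none

variable {e} {R t : ℕ}

/-- The label of a qubit of `A` is its block. [cite: BravyiPoulinTerhal2010, p. 2 and Fig. 1] -/
theorem blockLabel_eq_some_iff {q : Fin n} {ij : ℕ × ℕ} :
    blockLabel e R t q = some ij ↔
      ((e q 0 : ℕ) % (R + t) < R ∧ (e q 1 : ℕ) % (R + t) < R ∧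
        ¬ ((R ≤ (e q 0 : ℕ) % (R + t) + t ∨ (e q 0 : ℕ) % (R + t) < t) ∧
            (R ≤ (e q 1 : ℕ) % (R + t) + t ∨ (e q 1 : ℕ) % (R + t) < t))) ∧
      ((e q 0 : ℕ) / (R + t), (e q 1 : ℕ) / (R + t)) = ij := by
  unfold blockLabel
  split_ifs with h
  · simp [h]
  · exact ⟨fun h' => absurd h' (by simp), fun h' => absurd h'.1 h⟩

/-- The label of a qubit of `B` is its corridor segment. [cite: BravyiPoulinTerhal2010, p. 2 and Fig. 1] -/
theorem corridorLabel_eq_some {q : Fin n} {b : Bool} {i j : ℕ} (h : corridorLabel e R t q = some (b, i, j)) :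
    ((e q 0 : ℕ) / (R + t) = i ∧ (e q 1 : ℕ) / (R + t) = j) ∧
      ((b = true ∧ R ≤ (e q 0 : ℕ) % (R + t) ∧ t ≤ (e q 1 : ℕ) % (R + t) ∧ (e q 1 : ℕ) % (R + t) + t < R) ∨
        (b = false ∧ R ≤ (e q 1 : ℕ) % (R + t) ∧ t ≤ (e q 0 : ℕ) % (R + t) ∧
          (e q 0 : ℕ) % (R + t) + t < R)) := by
  unfold corridorLabel at h
  split_ifs at h with h1 h2
  · simp only [Option.some.injEq, Prod.mk.injEq] at h
    exact ⟨⟨h.2.1, h.2.2⟩, Or.inl ⟨h.1.symm, h1⟩⟩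
  · simp only [Option.some.injEq, Prod.mk.injEq] at h
    exact ⟨⟨h.2.1, h.2.2⟩, Or.inr ⟨h.1.symm, h2⟩⟩

/-- `A ⊔ B ⊔ C = Λ`: a qubit in neither `A` nor `B` lies in `C`.
[cite: BravyiPoulinTerhal2010, p. 2 and Fig. 1 («a partition of the lattice Λ = ABC»)] -/
theorem mem_cornerRegion_of_labels_none {q : Fin n} (hA : blockLabel e R t q = none)
    (hB : corridorLabel e R t q = none) : q ∈ cornerRegion e R t := by
  rw [cornerRegion, mem_box]
  simp only [badRes, mem_filter, mem_univ, true_and]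
  by_contra hC
  unfold blockLabel at hA
  unfold corridorLabel at hB
  by_cases hV : R ≤ (e q 0 : ℕ) % (R + t) ∧ t ≤ (e q 1 : ℕ) % (R + t) ∧ (e q 1 : ℕ) % (R + t) + t < R
  · rw [if_pos hV] at hB; exact absurd hB (by simp)
  by_cases hH : R ≤ (e q 1 : ℕ) % (R + t) ∧ t ≤ (e q 0 : ℕ) % (R + t) ∧ (e q 0 : ℕ) % (R + t) + t < R
  · rw [if_neg hV, if_pos hH] at hB; exact absurd hB (by simp)
  by_cases hA' : (e q 0 : ℕ) % (R + t) < R ∧ (e q 1 : ℕ) % (R + t) < R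
  · rw [if_pos ⟨hA'.1, hA'.2, hC⟩] at hA; exact absurd hA (by simp)
  · omega

/-- Every block of `A` lies inside an `R × R` square.
[cite: BravyiPoulinTerhal2010, p. 2 («each individual block in A and B is correctable»)] -/
theorem fiber_blockLabel_subset_sq (i j : ℕ) :
    fiber (blockLabel e R t) (some (i, j)) ⊆ sq e ((i * (R + t) : ℕ) : ℤ) ((j * (R + t) : ℕ) : ℤ) R := by
  intro q hq
  rw [mem_fiber, blockLabel_eq_some_iff] at hq
  obtain ⟨⟨hx, hy, -⟩, hij⟩ := hq
  simp only [Prod.mk.injEq] at hij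
  obtain ⟨rfl, rfl⟩ := hij
  have hdx := Nat.div_add_mod' (e q 0 : ℕ) (R + t)
  have hdy := Nat.div_add_mod' (e q 1 : ℕ) (R + t)
  rw [mem_sq]
  omega

/-- Every vertical corridor segment of `B` lies inside an `R × R` square.
[cite: BravyiPoulinTerhal2010, p. 2] -/
theorem fiber_corridorLabel_true_subset_sq (i j : ℕ) :
    fiber (corridorLabel e R t) (some (true, i, j)) ⊆
      sq e ((i * (R + t) + R : ℕ) : ℤ) ((j * (R + t) : ℕ) : ℤ) R := by
  intro q hq
  rw [mem_fiber] at hq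
  obtain ⟨⟨rfl, rfl⟩, h⟩ := corridorLabel_eq_some hq
  rcases h with ⟨-, h1, h2, h3⟩ | ⟨hb, -⟩
  · have hdx := Nat.div_add_mod' (e q 0 : ℕ) (R + t)
    have hdy := Nat.div_add_mod' (e q 1 : ℕ) (R + t)
    have hmx := Nat.mod_lt (e q 0 : ℕ) (show 0 < R + t by omega)
    rw [mem_sq]
    omega
  · exact absurd hb (by simp)

/-- Every horizontal corridor segment of `B` lies inside an `R × R` square.
[cite: BravyiPoulinTerhal2010, p. 2] -/
theorem fiber_corridorLabel_false_subset_sq (i j : ℕ) :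
    fiber (corridorLabel e R t) (some (false, i, j)) ⊆
      sq e ((i * (R + t) : ℕ) : ℤ) ((j * (R + t) + R : ℕ) : ℤ) R := by
  intro q hq
  rw [mem_fiber] at hq
  obtain ⟨⟨rfl, rfl⟩, h⟩ := corridorLabel_eq_some hq
  rcases h with ⟨hb, -⟩ | ⟨-, h1, h2, h3⟩
  · exact absurd hb (by simp)
  · have hdx := Nat.div_add_mod' (e q 0 : ℕ) (R + t)
    have hdy := Nat.div_add_mod' (e q 1 : ℕ) (R + t)
    have hmy := Nat.mod_lt (e q 1 : ℕ) (show 0 < R + t by omega)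
    rw [mem_sq]
    omega

/-- **Each generator meets at most one block of `A`** (range `t + 1`, blocks `≥ t` apart).
[cite: BravyiPoulinTerhal2010, p. 2 («any projector Π_a overlaps with at most one block in A»)] -/
theorem blockLabel_separated {v : SympVec n} (hv : IsCubeLocal e (t + 1) v) :
    ∀ q ∈ sympSupport v, ∀ q' ∈ sympSupport v, ∀ i i' : ℕ × ℕ,
      blockLabel e R t q = some i → blockLabel e R t q' = some i' → i = i' := by
  obtain ⟨c, hc⟩ := hv
  intro q hq q' hq' i i' hi hi'
  obtain ⟨⟨hx, hy, -⟩, rfl⟩ := blockLabel_eq_some_iff.1 hi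
  obtain ⟨⟨hx', hy', -⟩, rfl⟩ := blockLabel_eq_some_iff.1 hi'
  have h0 := hc q hq 0
  have h1 := hc q hq 1
  have h0' := hc q' hq' 0
  have h1' := hc q' hq' 1
  exact Prod.ext (div_eq_div_of_mod_lt' hx hx' (by omega) (by omega))
    (div_eq_div_of_mod_lt' hy hy' (by omega) (by omega))

/-- **Each generator meets at most one corridor segment of `B`** (range `t + 1`, `1 ≤ t ≤ R`).
[cite: BravyiPoulinTerhal2010, p. 2 («… and with at most one block in B»)] -/
theorem corridorLabel_separated (ht : 1 ≤ t) (hRt : t ≤ R) {v : SympVec n} (hv : IsCubeLocal e (t + 1) v) :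
    ∀ q ∈ sympSupport v, ∀ q' ∈ sympSupport v, ∀ i i' : Bool × ℕ × ℕ,
      corridorLabel e R t q = some i → corridorLabel e R t q' = some i' → i = i' := by
  obtain ⟨c, hc⟩ := hv
  rintro q hq q' hq' ⟨b, i, j⟩ ⟨b', i', j'⟩ hi hi'
  obtain ⟨⟨rfl, rfl⟩, h⟩ := corridorLabel_eq_some hi
  obtain ⟨⟨rfl, rfl⟩, h'⟩ := corridorLabel_eq_some hi'
  have h0 := hc q hq 0
  have h1 := hc q hq 1
  have h0' := hc q' hq' 0
  have h1' := hc q' hq' 1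
  rcases h with ⟨rfl, hV1, hV2, hV3⟩ | ⟨rfl, hH1, hH2, hH3⟩ <;>
    rcases h' with ⟨rfl, hV1', hV2', hV3'⟩ | ⟨rfl, hH1', hH2', hH3'⟩
  · exact Prod.ext rfl (Prod.ext (div_eq_div_of_le_mod ht hRt hV1 hV1' (by omega) (by omega))
      (div_eq_div_of_mod_lt' (by omega) (by omega) (by omega) (by omega)))
  · exact (false_of_le_mod_of_mod_add_lt hV1 hH2' hH3' (by omega) (by omega)).elim
  · exact (false_of_le_mod_of_mod_add_lt hV1' hH2 hH3 (by omega) (by omega)).elim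
  · exact Prod.ext rfl (Prod.ext (div_eq_div_of_mod_lt' (by omega) (by omega) (by omega) (by omega))
      (div_eq_div_of_le_mod ht hRt hH1 hH1' (by omega) (by omega)))

/-- `|C| ≤ (3t(L/(R+t) + 1))²` («`|C| ∼ n/R²`»). [cite: BravyiPoulinTerhal2010, Eq. (8) (p. 2: k ≤ |C| ∼ n/R²)] -/
theorem card_cornerRegion_le (ht : 1 ≤ t) (hRt : t ≤ R) :
    #(cornerRegion e R t) ≤ (3 * t * (L / (R + t) + 1)) * (3 * t * (L / (R + t) + 1)) := by
  have hb : #(badRes L R t) ≤ 3 * t * (L / (R + t) + 1) :=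
    card_filter_mod_le (L := L) (by omega) (fun r => R ≤ r + t ∨ r < t) (card_badResidues_le hRt)
  rw [cornerRegion, card_box]
  exact Nat.mul_le_mul hb hb

/-- **`k ≤ |C|` for the block partition.** If the generators have range `t + 1` (`1 ≤ t ≤ R`) and every `R × R`
square block is correctable, then `A` (blocks) and `B` (corridor segments) are correctable unions (Union Lemma) and
`k ≤ |C| ≤ (3t(L/(R+t)+1))²`. [cite: BravyiPoulinTerhal2010, Eqs. (5)–(8) and Fig. 1 (p. 2)] -/
theorem le_card_corner_of_isCorrectableRegion_sq {G : Type*} {g : G → SympVec n}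
    {S : Submodule (ZMod 2) (SympVec n)} {k d : ℕ} (hS : S = Submodule.span (ZMod 2) (Set.range g))
    (hcode : IsAdditiveCode S k d) (hg : ∀ a, IsCubeLocal e (t + 1) (g a)) (ht : 1 ≤ t) (hRt : t ≤ R)
    (hsq : ∀ a b, IsCorrectableRegion S (sq e a b R)) :
    k ≤ (3 * t * (L / (R + t) + 1)) * (3 * t * (L / (R + t) + 1)) := by
  classical
  have hA : IsCorrectableRegion S (univ.filter fun q => (blockLabel e R t q).isSome) :=
    isCorrectableRegion_of_fibers (blockLabel e R t) g hS (fun a => blockLabel_separated (hg a))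
      (fun ij => by
        obtain ⟨i, j⟩ := ij
        exact (hsq _ _).mono (fiber_blockLabel_subset_sq i j))
  have hB : IsCorrectableRegion S (univ.filter fun q => (corridorLabel e R t q).isSome) :=
    isCorrectableRegion_of_fibers (corridorLabel e R t) g hS (fun a => corridorLabel_separated ht hRt (hg a))
      (fun bij => by
        obtain ⟨b, i, j⟩ := bij
        cases b
        · exact (hsq _ _).mono (fiber_corridorLabel_false_subset_sq i j)
        · exact (hsq _ _).mono (fiber_corridorLabel_true_subset_sq i j))
  refine (le_card_compl_of_isCorrectable hcode hA hB).trans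
    ((card_le_card fun q hq => ?_).trans (card_cornerRegion_le (e := e) ht hRt))
  rw [mem_compl, mem_union, not_or] at hq
  simp only [mem_filter, mem_univ, true_and, Bool.not_eq_true, Option.isSome_eq_false_iff,
    Option.isNone_iff_eq_none] at hq
  exact mem_cornerRegion_of_labels_none hq.1 hq.2

end Tiling

end Grid

/-! ### The theorem -/

/-- `n = L²` for qubits placed bijectively on the `L × L` grid. [cite: BravyiPoulinTerhal2010, p. 1 («a regular square lattice of size √n × √n»)] -/
theorem eq_sq_of_equiv {L : ℕ} (e : Fin n ≃ (Fin 2 → Fin L)) : n = L * L := by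
  have h := Fintype.card_congr e
  simp only [Fintype.card_fin, Fintype.card_fun] at h
  rw [h, pow_two]

/-- **Bravyi–Poulin–Terhal 2010, `k d² ≤ c n` — proved** (discharge of `BravyiPoulinTerhal2010_kd2_le_cn`): for every
interaction range `w` there is `c = c(w) > 0` (here `c = 20736 t⁴`, `t = max(w,2) − 1`) such that every stabilizer
code on the `L × L` grid (`n = L²`, open boundaries) whose stabilizer space is spanned by generators each covered by
a `w × w` square satisfies `k d² ≤ c n` for its number of logical qubits `k` and every `d` below which it has no
logical operator. Proof as printed (Eqs. (5)–(8), Lemma 2, Cor. 1 iterated from `1 × 1` blocks, the partition of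
Fig. 1 with block period `R + t`), the Disentangling Lemma being replaced by the Cleaning Lemma for stabilizer codes,
and `d ≤ (t+1) L` (Bravyi–Terhal Thm. 1, `BravyiTerhal2009_d_le_c_sqrt_n_holds`) closing the arithmetic.
[cite: BravyiPoulinTerhal2010, Eq. (1) (p. 1) with the proof on pp. 2–4] -/
theorem BravyiPoulinTerhal2010_kd2_le_cn_holds : BravyiPoulinTerhal2010_kd2_le_cn := by
  intro w
  obtain ⟨t, ht, hwt⟩ : ∃ t : ℕ, 1 ≤ t ∧ w ≤ t + 1 := ⟨max w 2 - 1, by omega, by omega⟩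
  refine ⟨20736 * (t : ℝ) ^ 4, by positivity, ?_⟩
  intro L n k d e S hloc hcode
  suffices h : k * (d * d) ≤ 20736 * (t * t * (t * t)) * n by
    have h' : ((k * (d * d) : ℕ) : ℝ) ≤ ((20736 * (t * t * (t * t)) * n : ℕ) : ℝ) := by exact_mod_cast h
    have e1 : (k : ℝ) * (d : ℝ) ^ 2 = ((k * (d * d) : ℕ) : ℝ) := by push_cast; ring
    have e2 : 20736 * (t : ℝ) ^ 4 * n = ((20736 * (t * t * (t * t)) * n : ℕ) : ℝ) := by push_cast; ring
    rw [e1, e2]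
    exact h'
  have hn : n = L * L := eq_sq_of_equiv e
  have htt : 1 ≤ t * t * (t * t) := by
    have := Nat.mul_le_mul (Nat.mul_le_mul ht ht) (Nat.mul_le_mul ht ht)
    simpa using this
  rcases Nat.eq_zero_or_pos k with hk | hk
  · simp [hk]
  have hkn : k ≤ n := by have := hcode.2.1; omega
  have hloc' : HasLocalGenerators e (t + 1) S := hloc.mono hwt
  -- the local generators
  set T : Set (SympVec n) := {v | v ∈ S ∧ IsCubeLocal e (t + 1) v} with hT
  have hS : S = Submodule.span (ZMod 2) (Set.range (Subtype.val : T → SympVec n)) := by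
    rw [Subtype.range_coe]
    exact le_antisymm hloc' (Submodule.span_le.2 fun v hv => hv.1)
  have hg : ∀ a : T, IsCubeLocal e (t + 1) (a : SympVec n) := fun a => a.2.2
  rcases Nat.lt_or_ge d 2 with hd | hd
  · -- d ≤ 1 : k d² ≤ k ≤ n
    have hdd : d * d ≤ 1 := by
      have := Nat.mul_le_mul (show d ≤ 1 by omega) (show d ≤ 1 by omega)
      simpa using this
    calc k * (d * d) ≤ n * 1 := Nat.mul_le_mul hkn hdd
      _ = 1 * n := by ring
      _ ≤ 20736 * (t * t * (t * t)) * n := Nat.mul_le_mul_right n (by omega)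
  -- d ≥ 2 : Bravyi–Terhal gives d ≤ (t + 1) L
  have hBT : d ≤ (t + 1) * L := by
    have := BravyiTerhal2009_d_le_c_sqrt_n_holds 2 L (t + 1) n k d e S (by norm_num) (by omega) hloc' hcode hk
    simpa using this
  obtain ⟨R, -, hsq, hdR⟩ := exists_isCorrectableRegion_sq hS hcode.1 hg hcode.2.2.1 ht hd
  rcases Nat.lt_or_ge R t with hRt | hRt
  · -- small blocks: d < 24 t²
    have hd' : d ≤ 24 * (t * t) := by nlinarith [hdR, Nat.mul_le_mul_left (8 * t) hRt.le]
    calc k * (d * d) ≤ n * (24 * (t * t) * (24 * (t * t))) := Nat.mul_le_mul hkn (Nat.mul_le_mul hd' hd')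
      _ = 576 * (t * t * (t * t)) * n := by ring
      _ ≤ 20736 * (t * t * (t * t)) * n := by gcongr; norm_num
  -- the block partition of period R + t
  have hkC := le_card_corner_of_isCorrectableRegion_sq (e := e) hS hcode hg ht hRt hsq
  have hd24 : d ≤ 24 * t * (R + t) := by nlinarith [hdR, hRt, ht]
  rcases Nat.lt_or_ge L (R + t) with hL | hL
  · -- fewer than one period: k ≤ 9 t², d ≤ 2 t L
    rw [Nat.div_eq_of_lt hL] at hkC
    have hd2 : d ≤ 2 * t * L := by nlinarith [hBT, ht]
    calc k * (d * d) ≤ 3 * t * (0 + 1) * (3 * t * (0 + 1)) * (2 * t * L * (2 * t * L)) :=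
          Nat.mul_le_mul hkC (Nat.mul_le_mul hd2 hd2)
      _ = 36 * (t * t * (t * t)) * (L * L) := by ring
      _ ≤ 20736 * (t * t * (t * t)) * (L * L) := by gcongr; norm_num
      _ = 20736 * (t * t * (t * t)) * n := by rw [hn]
  · -- Q (R + t) ≤ 2 L where Q = L/(R+t) + 1, and Q d ≤ 48 t L
    have hQp : (L / (R + t) + 1) * (R + t) ≤ 2 * L := by
      have := Nat.div_mul_le_self L (R + t)
      rw [Nat.add_mul, one_mul]
      omega
    have hQd : (L / (R + t) + 1) * d ≤ 48 * t * L := by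
      calc (L / (R + t) + 1) * d ≤ (L / (R + t) + 1) * (24 * t * (R + t)) := Nat.mul_le_mul_left _ hd24
        _ = 24 * t * ((L / (R + t) + 1) * (R + t)) := by ring
        _ ≤ 24 * t * (2 * L) := Nat.mul_le_mul_left _ hQp
        _ = 48 * t * L := by ring
    calc k * (d * d) ≤ 3 * t * (L / (R + t) + 1) * (3 * t * (L / (R + t) + 1)) * (d * d) :=
          Nat.mul_le_mul_right _ hkC
      _ = 9 * (t * t) * ((L / (R + t) + 1) * d * ((L / (R + t) + 1) * d)) := by ring
      _ ≤ 9 * (t * t) * (48 * t * L * (48 * t * L)) := Nat.mul_le_mul_left _ (Nat.mul_le_mul hQd hQd)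
      _ = 20736 * (t * t * (t * t)) * (L * L) := by ring
      _ = 20736 * (t * t * (t * t)) * n := by rw [hn]

end Literature.InformationTheory.QuantumCodes
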